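import Mathlib
import Literature.Algebra.Lie.TensorBireflectionObstruction
import HarnessLib

/-!
# FLOOR-0 P2, ROAD-W toe-hold (L1) «scalar_of_dense»: a continuous family of linear operators that is scalar on a
# dense set is scalar everywhere
(ORGAN L1 of ROAD-W v1 239b1f58, step W3′ GLOB; desk F0P2-plan (g16) statement-first heads `ScalarOnDenseSubset…` 7916d6b26e5953c7
VERBATIM as (a)–(f); proof F0P3a-p06 (g14).)  Generic lemma (ROAD-W v1 239b1f58 W3′ toe-hold), parked under `Theorems/` for
provenance-lint reasons (`lint.literature-cited-only`: no print locus); upstream candidate (`Mathlib.Topology.Algebra.Module`).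

`𝕜` a complete nontrivially normed field, `V` a Hausdorff topological `𝕜`-vector space (NOT assumed finite-dimensional), `G` any
topological space, `ρ : G → End V` a family with continuous orbit maps `g ↦ ρ g v`.  Then `{g | ρ g is a scalar}` is closed: it is
`⋂ᵥ {g | ρ g v ∈ 𝕜 ∙ v}` and each line `𝕜 ∙ v` is closed (`Submodule.closed_of_finiteDimensional`), while «every vector an
eigenvector ⇒ scalar» is pure linear algebra (★ `Literature.Algebra.Lie.TensorObstruction.exists_eq_smul_id_of_forall_mem_span`,
imported, not restated).  Hence scalar on a dense subset ⇒ scalar; the scalar is a continuous function of `g` (the line map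
`c ↦ c • v₀` is a closed embedding, Mathlib `isClosedEmbedding_smul_left`), and a character when `ρ` is a homomorphism.

Heads: (a) `isClosed_setOf_forall_mem_span` · (b) `exists_forall_eq_smul_of_forall_mem_span` · (c) `isClosed_setOf_exists_forall_eq_smul`
· (d) **`scalar_of_dense`** (THE ORGAN) · (e) `exists_continuous_forall_eq_smul` · (f) `exists_continuous_character_of_dense`.

Sharpness of the binders (why `[CompleteSpace 𝕜]` and `[T2Space V]` are not decoration):
* `𝕜 = ℚ`, `V = ℝ` (a Hausdorff topological `ℚ`-module), `G = ℝ`, `ρ g = (g • ·)`, `S = ℚ`: scalar on the dense `S`, not scalar at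
  irrational `g` — completeness of `𝕜` is needed (`ℚ ∙ v` is not closed in `ℝ`, and `ℝ` has no non-zero continuous `ℚ`-functional);
* `V = 𝕜²` with the indiscrete topology: every orbit map is continuous, so nothing can be concluded — `T2Space V` is needed.
`G` carries NO algebraic structure except in (f) (a bare `Monoid`; no continuity of multiplication is used); orbit-map continuity
`∀ v, Continuous (fun g => ρ g v)` is the weakest continuity notion (joint continuity or continuity into `V →L[𝕜] V` imply it).
Model use: an `ℓ`-adic Galois representation that is scalar at a dense set of Frobenius elements is a character (Tate–Serre
globalisation step, ROAD-W v1 `F0/P2/ROAD-W.v1.F0P2-plan-g15.md` §2 W3′).  THEOREMS ONLY; imports Mathlib + one ★ Literature file +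
HarnessLib.

Cell hodgecm-mathlib (D-0151), FLOOR 0, crux item H413 = stmt-HodgeConjecture-24833; LEAD T10-39 (3) ∕ T10-41 ∕ T10-44, desk words
18:14:33Z (α)–(ε), reader F0P2-ref1 r321; lane `--kind proof --supports stmt-HodgeConjecture-24833 --as helper`; touches no registry
and no served Line.  HC_CM is proved only modulo the printed citations until rung 0 closes; this file proves nothing about them.
[folklore]
-/

set_option autoImplicit false
-- the mandated namespace repeats `HodgeConjecture.HodgeConjecture`, as in every `Theorems/*.lean` of this sub-problem
set_option linter.dupNamespace false

namespace Summit.HodgeConjecture.HodgeConjecture.Cruxes.H413.F0P2wScalarOfDense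

open Topology Set

variable {𝕜 : Type*} [NontriviallyNormedField 𝕜] [CompleteSpace 𝕜]
  {V : Type*} [AddCommGroup V] [Module 𝕜 V] [TopologicalSpace V] [IsTopologicalAddGroup V]
  [ContinuousSMul 𝕜 V] [T2Space V]
  {G : Type*} [TopologicalSpace G]

/-- (a) **The set of parameters at which every vector is an eigenvector is closed**: it is the intersection over `v` of the
preimages of the closed lines `𝕜 ∙ v` under the continuous orbit maps. [folklore] -/
theorem isClosed_setOf_forall_mem_span (ρ : G → V →ₗ[𝕜] V) (hρ : ∀ v, Continuous fun g => ρ g v) :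
    IsClosed {g | ∀ v, ρ g v ∈ 𝕜 ∙ v} := by
  have hset : {g | ∀ v, ρ g v ∈ 𝕜 ∙ v} = ⋂ v, (fun g => ρ g v) ⁻¹' ((𝕜 ∙ v : Submodule 𝕜 V) : Set V) := by
    ext g
    simp
  rw [hset]
  exact isClosed_iInter fun v => ((𝕜 ∙ v).closed_of_finiteDimensional).preimage (hρ v)

/-- (b) **Every vector an eigenvector ⇒ scalar** (pure algebra, any field; two-line glue over ★
`Literature.Algebra.Lie.TensorObstruction.exists_eq_smul_id_of_forall_mem_span`). [folklore] -/
theorem exists_forall_eq_smul_of_forall_mem_span {K W : Type*} [Field K] [AddCommGroup W] [Module K W]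
    (T : W →ₗ[K] W) (hT : ∀ v, T v ∈ K ∙ v) : ∃ c : K, ∀ v, T v = c • v := by
  obtain ⟨c, hc⟩ := Literature.Algebra.Lie.TensorObstruction.exists_eq_smul_id_of_forall_mem_span hT
  exact ⟨c, fun v => by simpa using LinearMap.congr_fun hc v⟩

/-- (c) **The set of parameters at which the operator is a scalar is closed** ((a) rewritten through (b)). [folklore] -/
theorem isClosed_setOf_exists_forall_eq_smul (ρ : G → V →ₗ[𝕜] V)
    (hρ : ∀ v, Continuous fun g => ρ g v) :
    IsClosed {g | ∃ c : 𝕜, ∀ v, ρ g v = c • v} := by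
  have hset : {g | ∃ c : 𝕜, ∀ v, ρ g v = c • v} = {g | ∀ v, ρ g v ∈ 𝕜 ∙ v} := by
    ext g
    simp only [Set.mem_setOf_eq]
    constructor
    · rintro ⟨c, hc⟩ v
      exact Submodule.mem_span_singleton.2 ⟨c, (hc v).symm⟩
    · intro h
      exact exists_forall_eq_smul_of_forall_mem_span (ρ g) h
  rw [hset]
  exact isClosed_setOf_forall_mem_span ρ hρ

/-- (d) **`scalar_of_dense` — scalar on a dense subset ⇒ scalar** (THE ORGAN).  `ρ : G → (V →ₗ[𝕜] V)` with continuous orbit maps,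
`V` a Hausdorff topological vector space over a complete nontrivially normed field `𝕜`, `S ⊆ G` dense: if `ρ g` is a scalar for
every `g ∈ S`, then `ρ g` is a scalar for every `g : G` (the closed set of (c) contains `S`, hence its closure `G`). [folklore] -/
theorem scalar_of_dense (ρ : G → V →ₗ[𝕜] V) (hρ : ∀ v, Continuous fun g => ρ g v)
    {S : Set G} (hS : Dense S) (h : ∀ g ∈ S, ∃ c : 𝕜, ∀ v, ρ g v = c • v) (g : G) :
    ∃ c : 𝕜, ∀ v, ρ g v = c • v := by
  have hsub : S ⊆ {g | ∃ c : 𝕜, ∀ v, ρ g v = c • v} := h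
  exact (isClosed_setOf_exists_forall_eq_smul ρ hρ).closure_subset_iff.mpr hsub (hS g)

/-- (e) **The scalar is a continuous function of the parameter** (for `V ≠ 0`; then it is also unique): with `v₀ ≠ 0`,
`χ g • v₀ = ρ g v₀` is continuous in `g` and `c ↦ c • v₀` is a closed embedding `𝕜 → V` (Mathlib `isClosedEmbedding_smul_left`,
which is where completeness and the Hausdorff property enter again). [folklore] -/
theorem exists_continuous_forall_eq_smul [Nontrivial V] (ρ : G → V →ₗ[𝕜] V)
    (hρ : ∀ v, Continuous fun g => ρ g v) (h : ∀ g, ∃ c : 𝕜, ∀ v, ρ g v = c • v) :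
    ∃ χ : G → 𝕜, Continuous χ ∧ ∀ g v, ρ g v = χ g • v := by
  obtain ⟨v₀, hv₀⟩ := exists_ne (0 : V)
  choose χ hχ using h
  refine ⟨χ, ?_, hχ⟩
  have hemb : IsClosedEmbedding fun x : 𝕜 => x • v₀ := isClosedEmbedding_smul_left hv₀
  rw [hemb.isEmbedding.continuous_iff]
  have hcomp : (fun x : 𝕜 => x • v₀) ∘ χ = fun g => ρ g v₀ := funext fun g => (hχ g v₀).symm
  rw [hcomp]
  exact hρ v₀

/-- (f) **Homomorphism version**: a representation `ρ : H →* (V →ₗ[𝕜] V)` of a monoid `H` (a topological space; no compatibility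
of the two structures is used) with continuous orbit maps that is scalar on a dense subset is a CONTINUOUS CHARACTER times the
identity: `ρ g v = χ g • v`, `χ : H →* 𝕜` continuous (multiplicativity read at a vector `v₀ ≠ 0`). [folklore] -/
theorem exists_continuous_character_of_dense {H : Type*} [Monoid H] [TopologicalSpace H]
    [Nontrivial V] (ρ : H →* (V →ₗ[𝕜] V)) (hρ : ∀ v, Continuous fun g => ρ g v)
    {S : Set H} (hS : Dense S) (h : ∀ g ∈ S, ∃ c : 𝕜, ∀ v, ρ g v = c • v) :
    ∃ χ : H →* 𝕜, Continuous χ ∧ ∀ g v, ρ g v = χ g • v := by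
  obtain ⟨χ, hχc, hχ⟩ :=
    exists_continuous_forall_eq_smul (fun g => ρ g) hρ (scalar_of_dense (fun g => ρ g) hρ hS h)
  obtain ⟨v₀, hv₀⟩ := exists_ne (0 : V)
  have h1 : χ 1 = 1 := by
    have key : χ 1 • v₀ = (1 : 𝕜) • v₀ := by
      rw [one_smul, ← hχ 1 v₀, map_one, Module.End.one_apply]
    exact smul_left_injective 𝕜 hv₀ key
  have hmul : ∀ a b, χ (a * b) = χ a * χ b := by
    intro a b
    have key : χ (a * b) • v₀ = (χ a * χ b) • v₀ := by
      rw [← hχ (a * b) v₀, map_mul, Module.End.mul_apply, hχ b v₀, map_smul, hχ a v₀, smul_smul,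
        mul_comm (χ b) (χ a)]
    exact smul_left_injective 𝕜 hv₀ key
  exact ⟨⟨⟨χ, h1⟩, hmul⟩, hχc, fun g v => by simpa using hχ g v⟩

end Summit.HodgeConjecture.HodgeConjecture.Cruxes.H413.F0P2wScalarOfDense
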